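import Mathlib.MeasureTheory.Integral.IntervalIntegral.FundThmCalculus
import Mathlib.Analysis.SpecialFunctions.Sqrt
import Mathlib.MeasureTheory.Measure.Lebesgue.EqHaar
import Literature.Analysis.FluidPDE.LocalTypeICongr
import HarnessLib

/-!
# Cubic absorption under the Type-I rate (ball form): the input (as11) of Seregin–Šverák 2009 Lemma 3.5 for a general field

This file is the ball / general-vertex transcription of
`SereginSverak2009.lintegral_cube_le_of_typeI` and `SereginSverak2009.CubicAbsorption_holds`
(file `Literature/Analysis/FluidPDE/SereginSverakScaledEnergyProofs.lean`), which prove the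
absorption estimate (as11) of the proof of Lemma 3.5 of

* G. Seregin, V. Šverák, *On Type I singularities of the local axi-symmetric solutions of the
  Navier–Stokes equations*, Comm. PDE 34 (2009), 171–201 = arXiv:0804.1803,

for Seregin–Šverák's coordinate cylinders `Q(z₀, r) = ]-r², 0[ × 𝒞(x₀, r)` with vertex time `0`
and the essential-supremum energy `energyA`. Here the same estimate is proved for the tree's
BALL cylinders `parabolicCylinder r z = ]t_z - r², t_z[ × B(x_z, r)` (`SuitableWeak.lean`) with a
general vertex `z = (t_z, x_z)`, the rate `√(t_z - t) ‖u(t, x)‖ ≤ K` a.e. on the cylinder, and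
Albritton–Barker's `A = cknAEss` (`LocalTypeI.lean`), `C = cknC`, `E = cknE`. It serves
Seregin's Lecture Notes, Prop. 3.11 (i) (the case `G₂ = sup √(-t) |v| < ∞`) for GENERAL suitable
weak solutions: the Type-I rate in `L∞` alone absorbs the cubic quantity `C` by `ε (E + A)` up to
a constant, which is the input of the Seregin–Šverák iteration bounding the scaled energies.

## The proof

Exactly as in `SereginSverakScaledEnergyProofs.lean`: split the time interval at
`t = t_z - (ηr)²`, `0 < η ≤ 1`.

* On the window `t_z - (ηr)² < t < t_z`: `|u|³ ≤ K (t_z - t)^{-1/2} |u|²`, the slices satisfy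
  `∫_{B(x_z, r)} |u(t)|² ≤ r A` for a.e. `t` (definition of `A` as an essential supremum), and
  `∫_{t_z-(ηr)²}^{t_z} K (t_z - t)^{-1/2} dt = 2Kηr` (`typeIRate_lintegral_majorant`), so this
  part of `∫_Q |u|³` is at most `2Kη · r² A`;
* before the window, `t_z - r² < t ≤ t_z - (ηr)²`: `|u| ≤ K/(ηr)` pointwise and
  `|Q_r(z)| = r⁵ |B₁|` (`typeIRate_volume_parabolicCylinder_eq`), so this part is at most
  `K³ η⁻³ · r² |B₁|`.

Hence `∫_{Q_r(z)} |u|³ ≤ 2Kη r² A + K³η⁻³ r² |B₁|` (`lintegral_cube_le_of_typeIRate`),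
`C ≤ 2Kη A + K³η⁻³ |B₁|` (`cknC_le_of_typeIRate`), and with `K = max(c, 1)`,
`η = min(1, ε/(2K))`, `F = K³η⁻³ |B₁|` one gets `C ≤ ε (E + A) + F` at every radius
`0 < r ≤ r₀` once the rate holds a.e. on `Q_{r₀}(z)` (`cubicAbsorption_of_typeIRate`). This is
(as2) of Seregin–Šverák in the limiting Hölder case `(s, l) = (∞, 1)`, localised to the window;
no symmetry, no dissipation and no pressure enter.

## Contents

* `typeIRate_volume_parabolicCylinder_eq`: `|Q_r(z)| = r⁵ |B₁|` (the tree's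
  `volume_parabolicCylinder` of `RusinSverakBackwardRegularity.lean`, reproved here to keep the
  imports small; the monotonicity `Q_r(z) ⊆ Q_{r₀}(z)`, `parabolicCylinder_mono` of
  `CKN1982Setting.lean`, is inlined where used);
* `typeIRate_lintegral_majorant`: `∫_{T-a²}^{T} K/√(T - t) dt = 2Ka` (FTC);
* `lintegral_cube_le_of_typeIRate`, `cknC_le_of_typeIRate`, `cubicAbsorption_of_typeIRate`.

## References

* G. Seregin, V. Šverák, Comm. PDE 34 (2009), 171–201 = arXiv:0804.1803, §3: proof of
  Lemma 3.5, (as2), (as11) (arXiv pp. 9–10). [`SereginSverak2009`]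
* G. Seregin, *Lecture Notes on Regularity Theory for the Navier–Stokes Equations*, World
  Scientific (2014), Ch. 3, Prop. 3.11 (i). [`Seregin2014`]
-/

noncomputable section

open MeasureTheory Set Function Filter Topology TopologicalSpace Metric
open scoped NNReal ENNReal

namespace Literature.Analysis.FluidPDE

/-! ### Volume of the ball cylinders -/

/-- Volume of a backward parabolic cylinder in `ℝ × ℝ³`: `|Q_r(z)| = r⁵ |B₁|` for `r > 0`
(`|]t_z - r², t_z[| = r²`, `|B(x_z, r)| = r³ |B₁|`). [folklore] -/
theorem typeIRate_volume_parabolicCylinder_eq {r : ℝ} (hr : 0 < r)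
    (z : ℝ × EuclideanSpace ℝ (Fin 3)) :
    volume (parabolicCylinder r z) =
      ENNReal.ofReal (r ^ 5) * volume (ball (0 : EuclideanSpace ℝ (Fin 3)) 1) := by
  rw [parabolicCylinder, Measure.volume_eq_prod, Measure.prod_prod, Real.volume_Ioo,
    Measure.addHaar_ball_of_pos volume z.2 hr, finrank_euclideanSpace_fin, ← mul_assoc,
    ← ENNReal.ofReal_mul (by nlinarith)]
  congr 2
  ring

/-! ### The Type I majorant in time -/

/-- `∫_{T-a²}^{T} K/√(T - t) dt = 2Ka` for `K, a ≥ 0`, as a lower Lebesgue integral: the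
integrability in time of the Type I majorant `K/√(T - t)` below the vertex time `T` (fundamental
theorem of calculus for `-2K√(T - t)`, whose derivative `K/√(T - t)` is nonnegative). [folklore] -/
theorem typeIRate_lintegral_majorant {K a : ℝ} (T : ℝ) (hK : 0 ≤ K) (ha : 0 ≤ a) :
    ∫⁻ t in Ioo (T - a ^ 2) T, ENNReal.ofReal (K / Real.sqrt (T - t)) =
      ENNReal.ofReal (2 * K * a) := by
  have hab : T - a ^ 2 ≤ T := by nlinarith [sq_nonneg a]
  have hcont : ContinuousOn (fun s : ℝ => -(2 * K * Real.sqrt (T - s))) (Icc (T - a ^ 2) T) :=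
    (Continuous.continuousOn (by fun_prop))
  have hderiv : ∀ t ∈ Ioo (T - a ^ 2) T,
      HasDerivAt (fun s : ℝ => -(2 * K * Real.sqrt (T - s))) (K / Real.sqrt (T - t)) t := by
    intro t ht
    have ht0 : T - t ≠ 0 := by have := ht.2; intro h; linarith
    have h2 := ((((hasDerivAt_id' t).const_sub T).sqrt ht0).const_mul (2 * K)).neg
    refine h2.congr_deriv ?_
    rw [neg_div, mul_neg, neg_neg, mul_one_div,
      mul_div_mul_left K (Real.sqrt (T - t)) two_ne_zero]
  have hpos : ∀ t ∈ Ioo (T - a ^ 2) T, 0 ≤ K / Real.sqrt (T - t) :=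
    fun t _ => div_nonneg hK (Real.sqrt_nonneg _)
  have hint : IntegrableOn (fun t : ℝ => K / Real.sqrt (T - t)) (Ioc (T - a ^ 2) T) :=
    intervalIntegral.integrableOn_deriv_of_nonneg hcont hderiv hpos
  have hFTC : ∫ t in (T - a ^ 2)..T, K / Real.sqrt (T - t) =
      -(2 * K * Real.sqrt (T - T)) - -(2 * K * Real.sqrt (T - (T - a ^ 2))) :=
    intervalIntegral.integral_eq_sub_of_hasDerivAt_of_le hab hcont hderiv
      ((intervalIntegrable_iff_integrableOn_Ioc_of_le hab).2 hint)
  calc ∫⁻ t in Ioo (T - a ^ 2) T, ENNReal.ofReal (K / Real.sqrt (T - t))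
      = ∫⁻ t in Ioc (T - a ^ 2) T, ENNReal.ofReal (K / Real.sqrt (T - t)) := by
        rw [Measure.restrict_congr_set Ioo_ae_eq_Ioc]
    _ = ENNReal.ofReal (∫ t in Ioc (T - a ^ 2) T, K / Real.sqrt (T - t)) := by
        rw [ofReal_integral_eq_lintegral_ofReal hint
          (Eventually.of_forall fun t => div_nonneg hK (Real.sqrt_nonneg _))]
    _ = ENNReal.ofReal (2 * K * a) := by
        rw [← intervalIntegral.integral_of_le hab, hFTC]
        simp [Real.sqrt_sq ha]

/-! ### The absorption estimate under the Type I rate -/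

/-- **The core of (as11) under the Type I rate, ball form.** If `√(t_z - t) ‖u(t, x)‖ ≤ K`
a.e. on `Q_r(z) = ]t_z - r², t_z[ × B(x_z, r)` (`K ≥ 0`, `r > 0`) and `u` is a.e. strongly
measurable there, then for every `0 < η ≤ 1`
`∫_{Q_r(z)} |u|³ ≤ 2Kη · r² A(Q_r(z)) + (K³/η³) · r² |B₁|`, `A = cknAEss` (essential supremum
in time): on the window `t_z - (ηr)² < t < t_z`, `|u|³ ≤ K (t_z - t)^{-1/2} |u|²`, the slices
carry `∫_{B(x_z, r)} |u(t)|² ≤ r A` for a.e. `t`, and `∫_{t_z-(ηr)²}^{t_z} K (t_z - t)^{-1/2} dt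
= 2Kηr`; before the window `|u| ≤ K/(ηr)` pointwise and `|Q_r(z)| = r⁵ |B₁|`. This is (as2) of
Seregin–Šverák in the limiting case `(s, l) = (∞, 1)`, `m = μ = 1` (Hölder only), localised to
the window; ball/general-vertex transcription of `SereginSverak2009.lintegral_cube_le_of_typeI`.
[cite: SereginSverak2009, proof of Lemma 3.5, (as2) and (as11) (arXiv pp. 9–10)]
[cite: Seregin2014, Ch. 3, Prop. 3.11 (i)] -/
theorem lintegral_cube_le_of_typeIRate {u : ℝ → EuclideanSpace ℝ (Fin 3) → EuclideanSpace ℝ (Fin 3)}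
    {z : ℝ × EuclideanSpace ℝ (Fin 3)} {r : ℝ} (hr : 0 < r) {K : ℝ} (hK : 0 ≤ K)
    (hu : AEStronglyMeasurable (uncurry u) (volume.restrict (parabolicCylinder r z)))
    (hI : ∀ᵐ w ∂(volume.restrict (parabolicCylinder r z)), Real.sqrt (z.1 - w.1) * ‖u w.1 w.2‖ ≤ K)
    {η : ℝ} (hη : 0 < η) (hη1 : η ≤ 1) :
    ∫⁻ w in parabolicCylinder r z, ‖u w.1 w.2‖ₑ ^ (3 : ℕ) ≤
      ENNReal.ofReal (2 * K * η) * ENNReal.ofReal r ^ 2 * cknAEss r z u +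
        ENNReal.ofReal (K ^ 3 / η ^ 3) * ENNReal.ofReal r ^ 2 *
          volume (ball (0 : EuclideanSpace ℝ (Fin 3)) 1) := by
  -- the volume of the cylinder, before any renaming
  have hvol : volume (parabolicCylinder r z) =
      ENNReal.ofReal (r ^ 5) * volume (ball (0 : EuclideanSpace ℝ (Fin 3)) 1) :=
    typeIRate_volume_parabolicCylinder_eq hr z
  -- notation
  set Q : Set (ℝ × EuclideanSpace ℝ (Fin 3)) := parabolicCylinder r z with hQ
  set I : Set ℝ := Ioo (z.1 - r ^ 2) z.1 with hIdef
  set S : Set (EuclideanSpace ℝ (Fin 3)) := ball z.2 r with hS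
  set J : Set ℝ := Ioo (z.1 - (η * r) ^ 2) z.1 with hJ
  set A : ℝ≥0∞ := cknAEss r z u with hA
  set ρ : ℝ≥0∞ := ENNReal.ofReal r with hρ
  have hρ0 : ρ ≠ 0 := (ENNReal.ofReal_pos.2 hr).ne'
  have hρT : ρ ≠ ⊤ := ENNReal.ofReal_ne_top
  have hQprod : Q = I ×ˢ S := rfl
  have hηr : 0 < η * r := mul_pos hη hr
  have hJI : J ⊆ I := by
    refine Ioo_subset_Ioo ?_ le_rfl
    have h2 : η * r ≤ r := mul_le_of_le_one_left hr.le hη1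
    have : (η * r) ^ 2 ≤ r ^ 2 := pow_le_pow_left₀ hηr.le h2 2
    linarith
  -- the majorant in time, supported on the window `J`
  set g : ℝ → ℝ≥0∞ := J.indicator fun t => ENNReal.ofReal (K / Real.sqrt (z.1 - t)) with hg
  have hg_meas : Measurable g := by
    refine Measurable.indicator ?_ measurableSet_Ioo
    fun_prop
  have hg_top : ∀ t, g t ≠ ⊤ := by
    intro t
    by_cases ht : t ∈ J
    · rw [hg, indicator_of_mem ht]; exact ENNReal.ofReal_ne_top
    · rw [hg, indicator_of_notMem ht]; exact ENNReal.zero_ne_top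
  set c₀ : ℝ≥0∞ := ENNReal.ofReal ((K / (η * r)) ^ 3) with hc₀
  -- Step 1: the pointwise bound, a.e. on `Q`
  have hpt : ∀ᵐ w ∂(volume.restrict Q),
      ‖u w.1 w.2‖ₑ ^ (3 : ℕ) ≤ g w.1 * ‖u w.1 w.2‖ₑ ^ 2 + c₀ := by
    filter_upwards [hI, ae_restrict_mem (isOpen_parabolicCylinder _ _).measurableSet] with w hw hwQ
    have ht : w.1 ∈ I := hwQ.1
    have ht0 : 0 < z.1 - w.1 := by have := ht.2; linarith
    have hs0 : 0 < Real.sqrt (z.1 - w.1) := Real.sqrt_pos.2 ht0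
    have hnorm : ‖u w.1 w.2‖ ≤ K / Real.sqrt (z.1 - w.1) := by
      rw [le_div_iff₀ hs0, mul_comm]; exact hw
    have he : ‖u w.1 w.2‖ₑ = ENNReal.ofReal ‖u w.1 w.2‖ := (ofReal_norm _).symm
    by_cases hwJ : w.1 ∈ J
    · have hgw : g w.1 = ENNReal.ofReal (K / Real.sqrt (z.1 - w.1)) := by
        rw [hg, indicator_of_mem hwJ]
      have hen : ‖u w.1 w.2‖ₑ ≤ ENNReal.ofReal (K / Real.sqrt (z.1 - w.1)) := by
        rw [he]; exact ENNReal.ofReal_le_ofReal hnorm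
      calc ‖u w.1 w.2‖ₑ ^ (3 : ℕ) = ‖u w.1 w.2‖ₑ * ‖u w.1 w.2‖ₑ ^ 2 := by ring
        _ ≤ g w.1 * ‖u w.1 w.2‖ₑ ^ 2 := by rw [hgw]; exact mul_le_mul' hen le_rfl
        _ ≤ g w.1 * ‖u w.1 w.2‖ₑ ^ 2 + c₀ := le_self_add
    · -- before the window: `w.1 ≤ t_z - (ηr)²`, so `√(t_z - w.1) ≥ ηr`
      have hle : w.1 ≤ z.1 - (η * r) ^ 2 := not_lt.1 fun h => hwJ ⟨h, ht.2⟩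
      have hsq : η * r ≤ Real.sqrt (z.1 - w.1) := by
        rw [Real.le_sqrt hηr.le ht0.le]; linarith
      have hnorm' : ‖u w.1 w.2‖ ≤ K / (η * r) :=
        hnorm.trans (div_le_div_of_nonneg_left hK hηr hsq)
      calc ‖u w.1 w.2‖ₑ ^ (3 : ℕ) = ENNReal.ofReal (‖u w.1 w.2‖ ^ 3) := by
            rw [he, ENNReal.ofReal_pow (norm_nonneg _)]
        _ ≤ c₀ := ENNReal.ofReal_le_ofReal (pow_le_pow_left₀ (norm_nonneg _) hnorm' 3)
        _ ≤ g w.1 * ‖u w.1 w.2‖ₑ ^ 2 + c₀ := le_add_self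
  -- Step 2: the slices, a.e. in `t` (definition of `A` as an essential supremum)
  have hslice : ∀ᵐ t ∂(volume.restrict I), ∫⁻ x in S, ‖u t x‖ₑ ^ 2 ≤ ρ * A := by
    have h : ∀ᵐ t ∂(volume.restrict I), ρ⁻¹ * ∫⁻ x in S, ‖u t x‖ₑ ^ 2 ≤ A :=
      ENNReal.ae_le_essSup _
    filter_upwards [h] with t ht
    calc ∫⁻ x in S, ‖u t x‖ₑ ^ 2 = ρ * (ρ⁻¹ * ∫⁻ x in S, ‖u t x‖ₑ ^ 2) := by
          rw [← mul_assoc, ENNReal.mul_inv_cancel hρ0 hρT, one_mul]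
      _ ≤ ρ * A := mul_le_mul' le_rfl ht
  -- Step 3: Tonelli on `Q = I × S`
  have hμ : volume.restrict Q = (volume.restrict I).prod (volume.restrict S) := by
    rw [hQprod]; exact (Measure.prod_restrict I S).symm
  have hF : AEMeasurable (fun w : ℝ × EuclideanSpace ℝ (Fin 3) => g w.1 * ‖u w.1 w.2‖ₑ ^ 2)
      (volume.restrict Q) :=
    (hg_meas.comp measurable_fst).aemeasurable.mul (hu.enorm.pow_const 2)
  have hF' : AEMeasurable (fun w : ℝ × EuclideanSpace ℝ (Fin 3) => g w.1 * ‖u w.1 w.2‖ₑ ^ 2)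
      ((volume.restrict I).prod (volume.restrict S)) := hμ ▸ hF
  have hmain : ∫⁻ w in Q, g w.1 * ‖u w.1 w.2‖ₑ ^ 2 ≤
      ENNReal.ofReal (2 * K * (η * r)) * (ρ * A) := by
    calc ∫⁻ w in Q, g w.1 * ‖u w.1 w.2‖ₑ ^ 2
        = ∫⁻ t in I, ∫⁻ x in S, g t * ‖u t x‖ₑ ^ 2 := by
          rw [hμ, lintegral_prod _ hF']
      _ = ∫⁻ t in I, g t * ∫⁻ x in S, ‖u t x‖ₑ ^ 2 :=
          lintegral_congr fun t => lintegral_const_mul' _ _ (hg_top t)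
      _ ≤ ∫⁻ t in I, g t * (ρ * A) :=
          lintegral_mono_ae (hslice.mono fun t ht => mul_le_mul' le_rfl ht)
      _ = (∫⁻ t in I, g t) * (ρ * A) := lintegral_mul_const _ hg_meas
      _ = (∫⁻ t in J, ENNReal.ofReal (K / Real.sqrt (z.1 - t))) * (ρ * A) := by
          rw [hg, lintegral_indicator measurableSet_Ioo,
            Measure.restrict_restrict measurableSet_Ioo, inter_eq_left.2 hJI]
      _ = ENNReal.ofReal (2 * K * (η * r)) * (ρ * A) := by
          rw [hJ, typeIRate_lintegral_majorant z.1 hK hηr.le]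
  -- Step 4: integrate the pointwise bound and collect the constants
  calc ∫⁻ w in Q, ‖u w.1 w.2‖ₑ ^ (3 : ℕ)
      ≤ ∫⁻ w in Q, (g w.1 * ‖u w.1 w.2‖ₑ ^ 2 + c₀) := lintegral_mono_ae hpt
    _ = (∫⁻ w in Q, g w.1 * ‖u w.1 w.2‖ₑ ^ 2) + c₀ * volume Q := by
        rw [lintegral_add_right _ measurable_const, setLIntegral_const]
    _ ≤ ENNReal.ofReal (2 * K * (η * r)) * (ρ * A) +
        c₀ * (ENNReal.ofReal (r ^ 5) * volume (ball (0 : EuclideanSpace ℝ (Fin 3)) 1)) :=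
        add_le_add hmain (mul_le_mul' le_rfl hvol.le)
    _ = ENNReal.ofReal (2 * K * η) * ρ ^ 2 * A +
        ENNReal.ofReal (K ^ 3 / η ^ 3) * ρ ^ 2 *
          volume (ball (0 : EuclideanSpace ℝ (Fin 3)) 1) := by
        have e1 : ENNReal.ofReal (2 * K * (η * r)) * (ρ * A) =
            ENNReal.ofReal (2 * K * η) * ρ ^ 2 * A := by
          rw [show 2 * K * (η * r) = (2 * K * η) * r by ring,
            ENNReal.ofReal_mul (by positivity), hρ]
          ring
        have e2 : c₀ * (ENNReal.ofReal (r ^ 5) * volume (ball (0 : EuclideanSpace ℝ (Fin 3)) 1)) =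
            ENNReal.ofReal (K ^ 3 / η ^ 3) * ρ ^ 2 *
              volume (ball (0 : EuclideanSpace ℝ (Fin 3)) 1) := by
          rw [hc₀, ← mul_assoc, ← ENNReal.ofReal_mul (by positivity), hρ,
            ← ENNReal.ofReal_pow hr.le, ← ENNReal.ofReal_mul (by positivity)]
          congr 2
          field_simp
        rw [e1, e2]

/-- **(as11) under the Type I rate, normalised ball form**: if `√(t_z - t) ‖u(t, x)‖ ≤ K` a.e.
on `Q_r(z)` (`K ≥ 0`, `r > 0`) and `u` is a.e. strongly measurable there, then for every
`0 < η ≤ 1`, `C(Q_r(z)) ≤ 2Kη · A(Q_r(z)) + (K³/η³) |B₁|` with `C = cknC = r⁻² ∫_{Q_r(z)} |u|³`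
and `A = cknAEss`: divide `lintegral_cube_le_of_typeIRate` by `r²`.
[cite: SereginSverak2009, proof of Lemma 3.5, (as11) (arXiv p. 10)]
[cite: Seregin2014, Ch. 3, Prop. 3.11 (i)] -/
theorem cknC_le_of_typeIRate {u : ℝ → EuclideanSpace ℝ (Fin 3) → EuclideanSpace ℝ (Fin 3)}
    {z : ℝ × EuclideanSpace ℝ (Fin 3)} {r : ℝ} (hr : 0 < r) {K : ℝ} (hK : 0 ≤ K)
    (hu : AEStronglyMeasurable (uncurry u) (volume.restrict (parabolicCylinder r z)))
    (hI : ∀ᵐ w ∂(volume.restrict (parabolicCylinder r z)), Real.sqrt (z.1 - w.1) * ‖u w.1 w.2‖ ≤ K)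
    {η : ℝ} (hη : 0 < η) (hη1 : η ≤ 1) :
    cknC r z u ≤ ENNReal.ofReal (2 * K * η) * cknAEss r z u +
      ENNReal.ofReal (K ^ 3 / η ^ 3) * volume (ball (0 : EuclideanSpace ℝ (Fin 3)) 1) := by
  have hcore := lintegral_cube_le_of_typeIRate hr hK hu hI hη hη1
  set ρ : ℝ≥0∞ := ENNReal.ofReal r with hρ
  have hρ0 : ρ ≠ 0 := (ENNReal.ofReal_pos.2 hr).ne'
  have hρT : ρ ≠ ⊤ := ENNReal.ofReal_ne_top
  have hρ2 : (ρ ^ 2)⁻¹ * ρ ^ 2 = 1 :=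
    ENNReal.inv_mul_cancel (pow_ne_zero _ hρ0) (ENNReal.pow_ne_top hρT)
  calc cknC r z u
      = (ρ ^ 2)⁻¹ * ∫⁻ w in parabolicCylinder r z, ‖u w.1 w.2‖ₑ ^ (3 : ℕ) := rfl
    _ ≤ (ρ ^ 2)⁻¹ * (ENNReal.ofReal (2 * K * η) * ρ ^ 2 * cknAEss r z u +
          ENNReal.ofReal (K ^ 3 / η ^ 3) * ρ ^ 2 *
            volume (ball (0 : EuclideanSpace ℝ (Fin 3)) 1)) :=
        mul_le_mul' le_rfl hcore
    _ = (ρ ^ 2)⁻¹ * ρ ^ 2 * (ENNReal.ofReal (2 * K * η) * cknAEss r z u +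
          ENNReal.ofReal (K ^ 3 / η ^ 3) * volume (ball (0 : EuclideanSpace ℝ (Fin 3)) 1)) := by
        ring
    _ = ENNReal.ofReal (2 * K * η) * cknAEss r z u +
          ENNReal.ofReal (K ^ 3 / η ^ 3) * volume (ball (0 : EuclideanSpace ℝ (Fin 3)) 1) := by
        rw [hρ2, one_mul]

/-- **Cubic absorption under the Type I rate (Seregin–Šverák 2009, (as11); Seregin 2014,
Prop. 3.11 (i), case `G₂`), ball form, general field.** If `u` is a.e. strongly measurable on
`Q_{r₀}(z)` and obeys the Type I rate `√(t_z - t) ‖u(t, x)‖ ≤ c` a.e. there, then for every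
`ε > 0` there is `F` with `C(Q_r(z)) ≤ ε (E(Q_r(z)) + A(Q_r(z))) + F` for all `0 < r ≤ r₀`
(`C = cknC`, `E = cknE` for any candidate gradient `G`, `A = cknAEss`): apply
`cknC_le_of_typeIRate` on `Q_r(z) ⊆ Q_{r₀}(z)` with `K = max(c, 1)` and the window parameter
`η = min(1, ε/(2K))`, so that `C ≤ 2Kη A + K³η⁻³ |B₁| ≤ ε A + F`, `F = K³η⁻³ |B₁|` (the printed
`f₁(ε, …)`); the dissipation `E` is not used. Ball/general-vertex transcription of
`SereginSverak2009.CubicAbsorption_holds`.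
[cite: SereginSverak2009, proof of Lemma 3.5, (as11) (arXiv p. 10)]
[cite: Seregin2014, Ch. 3, Prop. 3.11 (i)] -/
theorem cubicAbsorption_of_typeIRate {u : ℝ → EuclideanSpace ℝ (Fin 3) → EuclideanSpace ℝ (Fin 3)}
    {z : ℝ × EuclideanSpace ℝ (Fin 3)} {r₀ : ℝ} (hr₀ : 0 < r₀)
    (hu : AEStronglyMeasurable (uncurry u) (volume.restrict (parabolicCylinder r₀ z)))
    (hI : ∃ c : ℝ, ∀ᵐ w ∂(volume.restrict (parabolicCylinder r₀ z)), Real.sqrt (z.1 - w.1) * ‖u w.1 w.2‖ ≤ c)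
    (G : ℝ → EuclideanSpace ℝ (Fin 3) → EuclideanSpace ℝ (Fin 3) →L[ℝ] EuclideanSpace ℝ (Fin 3))
    {ε : ℝ≥0} (hε : 0 < ε) :
    ∃ F : ℝ≥0, ∀ r ∈ Ioc (0 : ℝ) r₀, cknC r z u ≤ ε * (cknE r z G + cknAEss r z u) + F := by
  -- only `0 < r ≤ r₀` is used below; `hr₀` belongs to the shared signature of the wave
  have _hr₀ := hr₀
  obtain ⟨c, hc⟩ := hI
  -- the Type I constant, made `≥ 1`
  set K : ℝ := max c 1 with hK
  have hK0 : 0 < K := lt_of_lt_of_le one_pos (le_max_right _ _)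
  have hcK : ∀ᵐ w ∂(volume.restrict (parabolicCylinder r₀ z)),
      Real.sqrt (z.1 - w.1) * ‖u w.1 w.2‖ ≤ K :=
    hc.mono fun w hw => hw.trans (le_max_left _ _)
  -- the window parameter `η`
  have hε0 : (0 : ℝ) < ε := by exact_mod_cast hε
  set η : ℝ := min 1 ((ε : ℝ) / (2 * K)) with hη
  have hη0 : 0 < η := lt_min one_pos (by positivity)
  have hη1 : η ≤ 1 := min_le_left _ _
  have hKη : 2 * K * η ≤ ε := by
    calc 2 * K * η ≤ 2 * K * ((ε : ℝ) / (2 * K)) := by gcongr; exact min_le_right _ _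
      _ = ε := by field_simp
  -- the constant `F = |B₁| K³ / η³`
  have hV : volume (ball (0 : EuclideanSpace ℝ (Fin 3)) 1) ≠ ⊤ := measure_ball_lt_top.ne
  set V : ℝ≥0 := (volume (ball (0 : EuclideanSpace ℝ (Fin 3)) 1)).toNNReal with hVdef
  have hVcoe : (V : ℝ≥0∞) = volume (ball (0 : EuclideanSpace ℝ (Fin 3)) 1) :=
    ENNReal.coe_toNNReal hV
  set F : ℝ≥0 := Real.toNNReal (K ^ 3 / η ^ 3) * V with hF
  have hFcoe :
      ENNReal.ofReal (K ^ 3 / η ^ 3) * volume (ball (0 : EuclideanSpace ℝ (Fin 3)) 1) = F := by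
    rw [hF, ENNReal.coe_mul, hVcoe]
    rfl
  have ha : ENNReal.ofReal (2 * K * η) ≤ ε := by
    rw [← ENNReal.ofReal_coe_nnreal]; exact ENNReal.ofReal_le_ofReal hKη
  refine ⟨F, fun r hr => ?_⟩
  -- the rate and measurability on `Q_r(z) ⊆ Q_{r₀}(z)`
  have hsub : parabolicCylinder r z ⊆ parabolicCylinder r₀ z := by
    have h2 : r ^ 2 ≤ r₀ ^ 2 := pow_le_pow_left₀ hr.1.le hr.2 2
    exact prod_mono (Ioo_subset_Ioo (by linarith) le_rfl) (ball_subset_ball hr.2)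
  have hur : AEStronglyMeasurable (uncurry u) (volume.restrict (parabolicCylinder r z)) :=
    hu.mono_measure (Measure.restrict_mono hsub le_rfl)
  have hIr : ∀ᵐ w ∂(volume.restrict (parabolicCylinder r z)),
      Real.sqrt (z.1 - w.1) * ‖u w.1 w.2‖ ≤ K :=
    ae_restrict_of_ae_restrict_of_subset hsub hcK
  calc cknC r z u
      ≤ ENNReal.ofReal (2 * K * η) * cknAEss r z u +
          ENNReal.ofReal (K ^ 3 / η ^ 3) * volume (ball (0 : EuclideanSpace ℝ (Fin 3)) 1) :=
        cknC_le_of_typeIRate hr.1 hK0.le hur hIr hη0 hη1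
    _ = ENNReal.ofReal (2 * K * η) * cknAEss r z u + F := by rw [hFcoe]
    _ ≤ ε * (cknE r z G + cknAEss r z u) + F :=
        add_le_add (mul_le_mul' ha le_add_self) le_rfl

end Literature.Analysis.FluidPDE
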